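import Summits.Langlands.Langlands.Theses.SenNullAlignment
import Literature.NumberTheory.Automorphic.HilbertPartialWeightOneGaloisRep
import HarnessLib

/-!
# `SenNullAlignment.OddNonRegularAttached` (stmt-Langlands-16362) from the named fact
# `exists_galoisRep_GL2_totallyReal_partialWeightOne` (Jarvis 1997 Thm. 6.1; Rogawski–Tunnell; Newton 2015 Thm. 1)

Stub₁ `stub_oddNonRegularAttached` of line `birth` of the crux `SeedParityLadder.HolomorphicSeedAvatars`
(stmt-Langlands-27035) is the TREE ITEM `Summit.Langlands.Langlands.Theses.SenNullAlignment.OddNonRegularAttached`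
(stmt-Langlands-16362) by name.  That item is, as recorded in the module docstring of
`Literature/NumberTheory/Automorphic/HilbertPartialWeightOneGaloisRep`, the named Literature fact
`Literature.NumberTheory.Automorphic.exists_galoisRep_GL2_totallyReal_partialWeightOne` INSTANTIATED: its inlined
weight-`(k, w)` infinity type is `hilbertInfinityType k w` and its Satake clause
`∀ᶠ v, Summit.Langlands.SatakeFrobCompatibleAt ι π.1 r v` is `SatakeFrobCompatibleAE ι π.1 r`, both
DEFINITIONALLY (the kernel accepts `exact`), and the item carries one extra idle hypothesis `∃ β, k β = 1`.

This file records that reduction as a CONDITIONAL result (D-0014 named-fact hypothesis): the published theorem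
is not proved in the tree, so `OddNonRegularAttached` (and with it stub₁) holds GRANTED the fact.  Nothing
else is claimed.

References: F. Jarvis, J. reine angew. Math. 491 (1997), Thm. 6.1 and end of §3 [Jarvis1997]; J. Newton,
Algebra Number Theory 9 (2015), Thm. 1, Rem. 2 [Newton2015LowWeight]; J. Rogawski, J. Tunnell, Invent. Math.
74 (1983) [RogawskiTunnell1983]; P. Deligne, J.-P. Serre, ASENS 7 (1974), Thm. 4.1 (`K = ℚ`).
-/

set_option linter.dupNamespace false

namespace Summit.Langlands.Langlands.Theorems.HolomorphicSeedAvatars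

open Literature.NumberTheory.Automorphic

/-- **`OddNonRegularAttached` from the print** (conditional result): granted the named fact
`exists_galoisRep_GL2_totallyReal_partialWeightOne` — for `K` totally real and `π` cuspidal `L`-algebraic on
`GL₂(𝔸_K)` of holomorphic weight `(k, w)` (limits of discrete series allowed, the idèle `-1` at every infinite
place acting by `-1`), every `ℓ`, `ι`, there is an irreducible `r : Γ_K → GL₂(ℚ̄_ℓ)` attached to `π` at almost
all places (Jarvis 1997 Thm. 6.1, irreducibility by Ribet's argument; Newton 2015 Thm. 1 / Rem. 2) — the route
item `SenNullAlignment.OddNonRegularAttached` (stmt-Langlands-16362) holds: it is that fact instantiated (the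
extra hypothesis `∃ β, k β = 1` is not used).  [cite: Jarvis1997, Thm. 6.1 (and end of §3)]
[cite: Newton2015LowWeight, Thm. 1 and Rem. 2] -/
theorem oddNonRegularAttached_of_partialWeightOne
    (h : exists_galoisRep_GL2_totallyReal_partialWeightOne) :
    Summit.Langlands.Langlands.Theses.SenNullAlignment.OddNonRegularAttached := by
  intro K _ _ hK hcpt π k w hL hT hsgn _ ℓ _ ι
  exact h K hK hcpt π k w hL hT hsgn ℓ ι

end Summit.Langlands.Langlands.Theorems.HolomorphicSeedAvatars
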